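import Summits.HodgeConjecture.HodgeConjecture.Theorems.HeckePrymWeilWeilSixfoldsSqrtMinus7HyperplaneCalculus
import Summits.HodgeConjecture.HodgeConjecture.Theorems.HeckePrymWeilAimedDescendingRationalModel
import Summits.HodgeConjecture.HodgeConjecture.Theorems.HeckePrymWeilWeilTwelvefoldsSqrtMinus7SymmetricSegre
import HarnessLib

/-!
# Crux `WeilSixfoldsSqrtMinus7` (stmt-HodgeConjecture-1260), line `hyperbolic-eightfold-descent` — sub-goal `stub_hyperplaneCalculusSym` of Stub 7 (aimed partner at `d = 7`)

**The hyperplane-class calculus on `complexBetti`, symmetrised form** (sub-goal G4′): ONE compatible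
family of rational classes `g_N ∈ H²(ℙᴺ_ℂ(ℂ); ℂ)` (in print `c₁(𝒪_{ℙᴺ}(1))` up to a rational unit) with
the five clauses of `stub_hyperplaneCalculus` — rational; `≠ 0` for `N ≥ 1`; `1 ≤ e.n` for embeddings of
positive-dimensional abelian varieties; Segre additivity `e^* g = pr₁^* e_X^* g + pr₂^* e_Y^* g` for the
Segre embedding `σ ∘ (e_X × e_Y)` of a product; weight-`m` re-embeddings `e^* g = m • e_X^* g` — and two
more:

6. **spanning**: every rational class of `H²(ℙᴺ(ℂ); ℂ)` is `t • g_N` with `t ∈ ℚ` (`N ≥ 1`: the group is a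
   line, Hatcher Thm. 3.19, spanned by the rational non-zero `g_N`, and two rational classes on a line
   differ by a rational factor, `Theorems.exists_eq_ratCast_smul_of_finrank_eq_one`; `N = 0`: the group
   vanishes, `ℙ⁰(ℂ)` being a point);
7. **`φ`-twisted re-embeddings**: for an endomorphism `φ` of the abelian variety `X` and `m ≥ 1` an
   embedding `e` with `e^* g = m • e_X^* g + φ^* e_X^* g` — the graph embedding
   `x ↦ σ(e_m x, e_X(φ x))`, i.e. `e = (𝟙, φ) ≫ (e_m ⊗ e_X) ≫ σ` with `e_m` the weight-`m` embedding:
   `(𝟙, φ)` is a closed immersion (`X` separated; the sibling crux's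
   `AmnesicSecantSheaves.isClosedImmersion_lift_id_left`), and
   `(𝟙, φ)^* (pr₁^* e_m^* g + pr₂^* e_X^* g) = m • e_X^* g + φ^* e_X^* g`.

With (6)–(7) the route's `K`-symmetrised class `7 • e^* a + φ^* e^* a` (`a` rational, so `a = t • g`) is
`e'^*(t • g)` for a PLAIN embedding `e'`, so Hodge–Riemann in degree one is only needed for plain hyperplane
classes (van Geemen 5.2–5.4; Markman §11.5 Step 2).

Proof. The family `g` is the rational, non-zero, Segre-additive family of the sibling crux
`WeilTwelvefoldsSqrtMinus7` (`AmnesicSecantSheaves.exists_segreHyperplaneClasses`, file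
`HeckePrymWeilWeilTwelvefoldsSqrtMinus7SegreHyperplaneClass`: the Euler class of the tautological line
bundle transported along Serre's `projPoint`, normalised by one rational scalar; the same construction as
this line's `stub_hyperplaneCalculus`). Everything else is formal in Segre additivity
`σ^* g = fst^* g + snd^* g`: `((ι_X ⊗ ι_Y) ≫ σ)^* g = fst^* ι_X^* g + snd^* ι_Y^* g`
(`(ι_X ⊗ ι_Y) ≫ fst = fst ≫ ι_X`), `((𝟙, f) ≫ (ι₁ ⊗ ι₂) ≫ σ)^* g = ι₁^* g + f^* ι₂^* g`, closed
immersions being stable under products and composition (Hartshorne II Ex. 3.11, 4.9); weights by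
induction with `f = 𝟙` (the diagonal), clause (7) with `f = φ`; `dim X ≤ N` for `X ↪ ℙᴺ`
(`le_of_isClosedImmersion_projectiveSpace`). No definition, no named fact; nothing unproved is used.

## References

* [Hartshorne1977] R. Hartshorne, *Algebraic Geometry* (1977), II Ex. 3.11, Cor. 4.2, Ex. 4.9, Ex. 5.11.
* [HatcherAT2002] A. Hatcher, *Algebraic Topology* (2002), Thm. 3.19.
* [vanGeemen1994HodgeAV] B. van Geemen, in LNM 1594 (1994), 5.2–5.4.
* [Markman2025] E. Markman, arXiv:2509.23403, §11.5 Step 2.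
-/

noncomputable section

-- single-problem summit (Problem = Summit): the mandated namespace repeats `HodgeConjecture`.
set_option linter.dupNamespace false

open CategoryTheory
open Literature.AlgebraicGeometry Literature.AlgebraicGeometry.Motives
  Literature.AlgebraicGeometry.HodgeTheory Literature.AlgebraicTopology.SingularHomology
  Literature.Geometry.Kaehler
open AlgebraicGeometry MonoidalCategory CartesianMonoidalCategory
open Summit.HodgeConjecture.HodgeConjecture.Theorems.WeilTwelvefoldsSqrtMinus7.AmnesicSecantSheaves

namespace Summit.HodgeConjecture.HodgeConjecture.Theorems.WeilSixfoldsSqrtMinus7.HyperbolicEightfoldDescent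

/-- **The hyperplane-class calculus on `complexBetti`, symmetrised form** (sub-goal G4′ of the aimed partner
at `d = 7`): a compatible family of rational hyperplane classes `g_N ∈ H²(ℙᴺ_ℂ(ℂ); ℂ)`, non-zero for
`N ≥ 1`, with `1 ≤ e.n` for embeddings of positive-dimensional abelian varieties, Segre additivity for the
Segre embedding of a product, weight-`m` re-embeddings, SPANNING (every rational class of `H²(ℙᴺ(ℂ); ℂ)` is
`t • g_N`, `t ∈ ℚ`) and `φ`-TWISTED re-embeddings `e^* g = m • e_X^* g + φ^* e_X^* g` (graph of `φ` into the
Segre product of the weight-`m` embedding and `e_X`). The family is the Segre-additive rational family of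
`AmnesicSecantSheaves.exists_segreHyperplaneClasses` (`σ^* 𝒪(1) = 𝒪(1) ⊠ 𝒪(1)`, Hartshorne II Ex. 5.11);
the rest is naturality of pull-backs and stability of closed immersions.
[cite: Hartshorne1977, II Ex. 5.11 and II Cor. 4.2] [cite: HatcherAT2002, Thm. 3.19] [cite: vanGeemen1994HodgeAV, 5.2–5.4] -/
theorem stub_hyperplaneCalculusSym :
    ∃ g : ∀ N : ℕ, complexBetti (projectiveSpace N ℂ) 2,
      (∀ N, IsRationalClass (g N)) ∧ (∀ N, 1 ≤ N → g N ≠ 0) ∧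
      (∀ (X : AbelianVariety ℂ) (e : ProjectiveEmbedding X.X), 1 ≤ X.dim → 1 ≤ e.n) ∧
      (∀ (X Y : AbelianVariety ℂ) (eX : ProjectiveEmbedding X.X) (eY : ProjectiveEmbedding Y.X),
        ∃ e : ProjectiveEmbedding (X.prod Y).X,
          complexBetti.map e.ι 2 (g e.n) =
            complexBetti.map (AbelianVariety.fst X Y).hom.hom.hom 2 (complexBetti.map eX.ι 2 (g eX.n)) +
            complexBetti.map (AbelianVariety.snd X Y).hom.hom.hom 2 (complexBetti.map eY.ι 2 (g eY.n))) ∧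
      (∀ (X : AbelianVariety ℂ) (eX : ProjectiveEmbedding X.X) (m : ℕ), 0 < m →
        ∃ e : ProjectiveEmbedding X.X,
          complexBetti.map e.ι 2 (g e.n) = (m : ℂ) • complexBetti.map eX.ι 2 (g eX.n)) ∧
      (∀ (N : ℕ) (a : complexBetti (projectiveSpace N ℂ) 2), IsRationalClass a →
        ∃ t : ℚ, a = ((t : ℚ) : ℂ) • g N) ∧
      (∀ (X : AbelianVariety ℂ) (φ : X ⟶ X) (eX : ProjectiveEmbedding X.X) (m : ℕ), 0 < m →
        ∃ e : ProjectiveEmbedding X.X,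
          complexBetti.map e.ι 2 (g e.n) =
            (m : ℂ) • complexBetti.map eX.ι 2 (g eX.n) +
              complexBetti.map φ.hom.hom.hom 2 (complexBetti.map eX.ι 2 (g eX.n))) := by
  obtain ⟨g, hrat, hne, hadd⟩ := exists_segreHyperplaneClasses
  -- `((ι_X ⊗ ι_Y) ≫ σ)^* g = fst^* ι_X^* g + snd^* ι_Y^* g`
  have hten : ∀ {X Y : SchemeOver ℂ} {a b : ℕ} (ιX : X ⟶ projectiveSpace a ℂ) (ιY : Y ⟶ projectiveSpace b ℂ),
      complexBetti.map ((ιX ⊗ₘ ιY) ≫ segreEmbedding a b ℂ) 2 (g (a * b + a + b)) =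
        complexBetti.map (fst X Y) 2 (complexBetti.map ιX 2 (g a)) +
          complexBetti.map (snd X Y) 2 (complexBetti.map ιY 2 (g b)) := by
    intro X Y a b ιX ιY
    rw [map_comp_apply', hadd, map_add, map_tensorHom_map_fst, map_tensorHom_map_snd]
  -- `((𝟙, f) ≫ (ι₁ ⊗ ι₂) ≫ σ)^* g = ι₁^* g + f^* ι₂^* g`
  have hgraph : ∀ {X Y : SchemeOver ℂ} {a b : ℕ} (f : X ⟶ Y) (ι₁ : X ⟶ projectiveSpace a ℂ)
      (ι₂ : Y ⟶ projectiveSpace b ℂ),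
      complexBetti.map (lift (𝟙 X) f ≫ (ι₁ ⊗ₘ ι₂) ≫ segreEmbedding a b ℂ) 2 (g (a * b + a + b)) =
        complexBetti.map ι₁ 2 (g a) + complexBetti.map f 2 (complexBetti.map ι₂ 2 (g b)) := by
    intro X Y a b f ι₁ ι₂
    rw [map_comp_apply', hten, map_add, map_lift_map_fst, map_lift_map_snd, complexBetti.map_id]
    rfl
  -- `(ι_X ⊗ ι_Y) ≫ σ` is a closed immersion
  have hci : ∀ {X Y : SchemeOver ℂ} {a b : ℕ} (ιX : X ⟶ projectiveSpace a ℂ) (ιY : Y ⟶ projectiveSpace b ℂ)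
      [IsClosedImmersion ιX.left] [IsClosedImmersion ιY.left],
      IsClosedImmersion ((ιX ⊗ₘ ιY) ≫ segreEmbedding a b ℂ).left := by
    intro X Y a b ιX ιY _ _
    have := isClosedImmersion_tensorHom_left ιX ιY
    change IsClosedImmersion ((ιX ⊗ₘ ιY).left ≫ (segreEmbedding a b ℂ).left)
    infer_instance
  -- graph embeddings `(𝟙, f) ≫ (ι₁ ⊗ ι₂) ≫ σ` of an abelian variety, with their class
  have hemb : ∀ (X : AbelianVariety ℂ) (f : X.X ⟶ X.X) (e₁ e₂ : ProjectiveEmbedding X.X),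
      ∃ e : ProjectiveEmbedding X.X, complexBetti.map e.ι 2 (g e.n) =
        complexBetti.map e₁.ι 2 (g e₁.n) + complexBetti.map f 2 (complexBetti.map e₂.ι 2 (g e₂.n)) := by
    intro X f e₁ e₂
    haveI := isClosedImmersion_lift_id_left f
    haveI := hci e₁.ι e₂.ι
    refine ⟨⟨e₁.n * e₂.n + e₁.n + e₂.n, lift (𝟙 X.X) f ≫ (e₁.ι ⊗ₘ e₂.ι) ≫ segreEmbedding e₁.n e₂.n ℂ, ?_⟩,
      hgraph f e₁.ι e₂.ι⟩
    change IsClosedImmersion ((lift (𝟙 X.X) f).left ≫ ((e₁.ι ⊗ₘ e₂.ι) ≫ segreEmbedding e₁.n e₂.n ℂ).left)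
    infer_instance
  -- weight-`m` re-embeddings (diagonal, `f = 𝟙`)
  have hweight : ∀ (X : AbelianVariety ℂ) (eX : ProjectiveEmbedding X.X) (m : ℕ), 0 < m →
      ∃ e : ProjectiveEmbedding X.X, complexBetti.map e.ι 2 (g e.n) = (m : ℂ) • complexBetti.map eX.ι 2 (g eX.n) := by
    intro X eX m hm
    induction m with
    | zero => exact absurd hm (lt_irrefl 0)
    | succ m ih =>
      rcases Nat.eq_zero_or_pos m with rfl | hm'
      · exact ⟨eX, by rw [Nat.zero_add, Nat.cast_one, one_smul]⟩
      · obtain ⟨e₁, he₁⟩ := ih hm'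
        obtain ⟨e, he⟩ := hemb X (𝟙 X.X) e₁ eX
        refine ⟨e, ?_⟩
        rw [he, he₁, complexBetti.map_id, Nat.cast_succ, add_smul, one_smul]
        rfl
  refine ⟨g, hrat, hne, fun X e h => h.trans (le_of_isClosedImmersion_projectiveSpace
      (X.isSmoothProjective_of_isProjectiveOver e.isProjectiveOver) e.ι), fun X Y eX eY => ?_, hweight,
    fun N a ha => ?_, fun X φ eX m hm => ?_⟩
  · -- Segre additivity for `X × Y`
    exact ⟨⟨eX.n * eY.n + eX.n + eY.n, (eX.ι ⊗ₘ eY.ι) ≫ segreEmbedding eX.n eY.n ℂ, hci eX.ι eY.ι⟩, hten eX.ι eY.ι⟩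
  · -- spanning
    rcases Nat.eq_zero_or_pos N with rfl | hN
    · haveI : Subsingleton (complexBetti (projectiveSpace 0 ℂ) 2) :=
        ComplexPoints.subsingleton_singularCohomology_of_lt (isSmoothProjective_projectiveSpace' 0) ℂ (k := 2) (by omega)
      exact ⟨0, Subsingleton.elim _ _⟩
    · exact exists_eq_ratCast_smul_of_finrank_eq_one
        (finrank_complexBetti_projectiveSpace_two_mul_eq_one N (p := 1) hN) (hrat N) (hne N hN) ha
  · -- `φ`-twisted re-embedding: graph of `φ` into the Segre product of the weight-`m` embedding and `e_X`
    obtain ⟨e₁, he₁⟩ := hweight X eX m hm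
    obtain ⟨e, he⟩ := hemb X φ.hom.hom.hom e₁ eX
    exact ⟨e, by rw [he, he₁]⟩

end Summit.HodgeConjecture.HodgeConjecture.Theorems.WeilSixfoldsSqrtMinus7.HyperbolicEightfoldDescent

end
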